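import Mathlib.Analysis.Convex.Mul
import Literature.Geometry.Lorentzian.KerrSchild
import Literature.Geometry.Lorentzian.KerrWaveEnergy
import HarnessLib

/-!
# `KerrRadiusSublevelConvex`: the sublevel sets of the Kerr–Schild radius are convex
(crux `GapExhaustion`, stmt-FinalStateConjecture-10808, line photon-shell-pseudoconvexity;
stub (S-1) `stub_kerrRadius_sublevel_convex` of the §1g SWEEP: the abstract level-set sweep
patches local Killing extensions near two points `x, x'` of a Kerr–Schild cylinder `{r = c}` on
the lens `ball x ρ ∩ ball x' ρ`, which must meet the inner side `{r < c}` — a consequence of the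
convexity of the sublevel sets of the level function `r = Kerr.radius a`)

For the Kerr–Schild radius `r = Kerr.radius a x`, the nonnegative root of the quartic
`r⁴ − (‖x⃗‖² − a²) r² − a² x₃² = 0` (`Kerr.radius_quartic`, `Kerr.radius_sq`), and every `c > 0`
(ANY `a`), the sublevel sets `{r < c}` and `{r ≤ c}` are the solid confocal ellipsoids
`c² (x₁² + x₂²) + (c² + a²) x₃² < c² (c² + a²)` (resp. `≤`) times the free time coordinate `x₀`
(O'Neill, *The geometry of Kerr black holes* (1995), Ch. 2, §2.1: the level sets `{r = c}` are
the confocal ellipsoids `(x² + y²)/(c² + a²) + z²/c² = 1`; Visser arXiv:0706.0622, (35)), hence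
convex (strict/non-strict sublevel sets of the convex quadratic form
`q(x) = c² (x₁² + x₂²) + (c² + a²) x₃²`, `kerrSublevel_convexOn_quadric`).

The key algebraic identity (`kerrSublevel_key`) is the factorisation of the quartic polynomial
`p(u) = u² − (‖x⃗‖² − a²) u − a² x₃²` at `u = c²`:
`c² (c² + a²) − q(x) = p(c²) = (c² − r²) (c² + r² − (‖x⃗‖² − a²))`,
whose second factor is `≥ c² > 0` because
`2 r² − (‖x⃗‖² − a²) = √((‖x⃗‖² − a²)² + 4 a² x₃²) ≥ |‖x⃗‖² − a²|`, i.e. `‖x⃗‖² − a² ≤ r²`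
(`Kerr.spatialNorm_sq_sub_sq_le_radius_sq` of `KerrWaveEnergy.lean`); so the sign of
`c² (c² + a²) − q(x)` is the sign of `c² − r²`, i.e. of `c − r` (`r ≥ 0`, `c > 0`).
-/

noncomputable section

-- D-0017: single-problem summit, `Summit.<S>.<S>.…` by design (cf. lakefile `weak.linter.dupNamespace`).
set_option linter.dupNamespace false

namespace Summit.FinalStateConjecture.FinalStateConjecture.Theorems

open Set Literature.Geometry.Lorentzian
open scoped Manifold ContDiff Topology ENNReal

/-- The confocal quadratic form `q(x) = c² (x₁² + x₂²) + (c² + a²) x₃²` is a convex function on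
`E4` (a nonnegative combination of the squares of coordinate functionals); its sublevel set
`{q < c² (c² + a²)}` is the solid ellipsoid `{r < c}` times the time axis (O'Neill 1995, Ch. 2,
§2.1). [folklore] -/
theorem kerrSublevel_convexOn_quadric (a c : ℝ) :
    ConvexOn ℝ univ fun x : E4 => c ^ 2 * (x 1 ^ 2 + x 2 ^ 2) + (c ^ 2 + a ^ 2) * x 3 ^ 2 := by
  have hsq : ∀ i : Fin 4, ConvexOn ℝ univ (fun x : E4 => x i ^ 2) := fun i => by
    have h := (Even.convexOn_pow (𝕜 := ℝ) even_two).comp_linearMap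
      (EuclideanSpace.proj (𝕜 := ℝ) i).toLinearMap
    simpa [Set.preimage_univ, Function.comp_def] using h
  have hA : 0 ≤ c ^ 2 := sq_nonneg c
  have hB : 0 ≤ c ^ 2 + a ^ 2 := by positivity
  have h := (((hsq 1).add (hsq 2)).smul hA).add ((hsq 3).smul hB)
  refine h.congr fun x _ => ?_
  simp only [Pi.add_apply, smul_eq_mul]

/-- **Key factorisation.** With `r = Kerr.radius a x` and `q = c² (x₁² + x₂²) + (c² + a²) x₃²`:
`c² (c² + a²) − q = (c² − r²) (c² + r² − (‖x⃗‖² − a²))` — the quartic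
`p(u) = u² − (‖x⃗‖² − a²) u − a² x₃²` (`Kerr.radius_quartic`: `p(r²) = 0`) evaluated at
`u = c²`, with `‖x⃗‖² = x₁² + x₂² + x₃²` (`E4.spatialNorm_sq`). [folklore] -/
theorem kerrSublevel_key (a c : ℝ) (x : E4) :
    c ^ 2 * (c ^ 2 + a ^ 2) - (c ^ 2 * (x 1 ^ 2 + x 2 ^ 2) + (c ^ 2 + a ^ 2) * x 3 ^ 2) =
      (c ^ 2 - Kerr.radius a x ^ 2) *
        (c ^ 2 + Kerr.radius a x ^ 2 - (E4.spatialNorm x ^ 2 - a ^ 2)) := by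
  linear_combination Kerr.radius_quartic a x + c ^ 2 * E4.spatialNorm_sq x

/-- **`{r < c}` is the open solid confocal ellipsoid**: for `c > 0`,
`Kerr.radius a x < c ↔ c² (x₁² + x₂²) + (c² + a²) x₃² < c² (c² + a²)` (O'Neill 1995, Ch. 2,
§2.1; Visser arXiv:0706.0622, (35)). [cite: ONeill1995, Ch. 2 §2.1] -/
theorem kerrSublevel_radius_lt_iff {a c : ℝ} (hc : 0 < c) (x : E4) :
    Kerr.radius a x < c ↔
      c ^ 2 * (x 1 ^ 2 + x 2 ^ 2) + (c ^ 2 + a ^ 2) * x 3 ^ 2 < c ^ 2 * (c ^ 2 + a ^ 2) := by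
  have hr := Kerr.radius_nonneg a x
  have hkey := kerrSublevel_key a c x
  have hpos : 0 < c ^ 2 + Kerr.radius a x ^ 2 - (E4.spatialNorm x ^ 2 - a ^ 2) := by
    have := Kerr.spatialNorm_sq_sub_sq_le_radius_sq a x
    nlinarith
  constructor
  · intro h
    have h1 : 0 < c ^ 2 - Kerr.radius a x ^ 2 := by nlinarith
    have h2 := mul_pos h1 hpos
    linarith [hkey]
  · intro h
    have h1 : 0 < (c ^ 2 - Kerr.radius a x ^ 2) *
        (c ^ 2 + Kerr.radius a x ^ 2 - (E4.spatialNorm x ^ 2 - a ^ 2)) := by linarith [hkey]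
    have h2 : 0 < c ^ 2 - Kerr.radius a x ^ 2 := (pos_iff_pos_of_mul_pos h1).2 hpos
    nlinarith

/-- **`{r ≤ c}` is the closed solid confocal ellipsoid**: for `c > 0`,
`Kerr.radius a x ≤ c ↔ c² (x₁² + x₂²) + (c² + a²) x₃² ≤ c² (c² + a²)` (O'Neill 1995, Ch. 2,
§2.1; Visser arXiv:0706.0622, (35)). [cite: ONeill1995, Ch. 2 §2.1] -/
theorem kerrSublevel_radius_le_iff {a c : ℝ} (hc : 0 < c) (x : E4) :
    Kerr.radius a x ≤ c ↔
      c ^ 2 * (x 1 ^ 2 + x 2 ^ 2) + (c ^ 2 + a ^ 2) * x 3 ^ 2 ≤ c ^ 2 * (c ^ 2 + a ^ 2) := by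
  have hr := Kerr.radius_nonneg a x
  have hkey := kerrSublevel_key a c x
  have hpos : 0 < c ^ 2 + Kerr.radius a x ^ 2 - (E4.spatialNorm x ^ 2 - a ^ 2) := by
    have := Kerr.spatialNorm_sq_sub_sq_le_radius_sq a x
    nlinarith
  constructor
  · intro h
    have h1 : 0 ≤ c ^ 2 - Kerr.radius a x ^ 2 := by nlinarith
    have h2 := mul_nonneg h1 hpos.le
    linarith [hkey]
  · intro h
    have h1 : 0 ≤ (c ^ 2 - Kerr.radius a x ^ 2) *
        (c ^ 2 + Kerr.radius a x ^ 2 - (E4.spatialNorm x ^ 2 - a ^ 2)) := by linarith [hkey]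
    have h2 : 0 ≤ c ^ 2 - Kerr.radius a x ^ 2 := nonneg_of_mul_nonneg_left h1 hpos
    nlinarith

/-- **(S-1) The sublevel sets of the Kerr–Schild radius are convex.** For every `a` and every
`c > 0` the sets `{r < c}` and `{r ≤ c}` (`r = Kerr.radius a`) are the solid confocal ellipsoids
`c² (x₁² + x₂²) + (c² + a²) x₃² < c² (c² + a²)` (resp. `≤`) times the time axis
(`kerrSublevel_radius_lt_iff`, `kerrSublevel_radius_le_iff`), strict/non-strict sublevel sets of
the convex quadratic form `c² (x₁² + x₂²) + (c² + a²) x₃²` (`kerrSublevel_convexOn_quadric`),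
hence convex (O'Neill 1995, Ch. 2, §2.1; Visser arXiv:0706.0622, (35)). [cite: ONeill1995, Ch. 2 §2.1] -/
theorem stub_kerrRadius_sublevel_convex :
    ∀ (a c : ℝ), 0 < c →
      Convex ℝ {x : E4 | Kerr.radius a x < c} ∧ Convex ℝ {x : E4 | Kerr.radius a x ≤ c} := by
  intro a c hc
  have hconv := kerrSublevel_convexOn_quadric a c
  constructor
  · have h := hconv.convex_lt (c ^ 2 * (c ^ 2 + a ^ 2))
    have hset : {x : E4 | Kerr.radius a x < c} = {x ∈ (univ : Set E4) |
        c ^ 2 * (x 1 ^ 2 + x 2 ^ 2) + (c ^ 2 + a ^ 2) * x 3 ^ 2 < c ^ 2 * (c ^ 2 + a ^ 2)} := by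
      ext x
      simp only [mem_setOf_eq, mem_univ, true_and, kerrSublevel_radius_lt_iff hc x]
    rw [hset]
    exact h
  · have h := hconv.convex_le (c ^ 2 * (c ^ 2 + a ^ 2))
    have hset : {x : E4 | Kerr.radius a x ≤ c} = {x ∈ (univ : Set E4) |
        c ^ 2 * (x 1 ^ 2 + x 2 ^ 2) + (c ^ 2 + a ^ 2) * x 3 ^ 2 ≤ c ^ 2 * (c ^ 2 + a ^ 2)} := by
      ext x
      simp only [mem_setOf_eq, mem_univ, true_and, kerrSublevel_radius_le_iff hc x]
    rw [hset]
    exact h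

end Summit.FinalStateConjecture.FinalStateConjecture.Theorems

end
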